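/-
Copyright (c) 2026 the pub-hodgecm-mathlib formalisation cell (harness21).  Prover seat hodgecm-mathlib-F0P3a-p01 (g33), req620 Track A «(D-RAM) FOUR-FRAME» squad, unit U2H:
the (ρ2b′-X) child (U2H ED. 15 :418) — organ T3-E part 2, FILE D «THE EIGEN-FIELD PACKAGE OF A TYPE-(2) BLOCK, ASSEMBLED» (plan `T3E-PART2-PLAN.v1` 333f6514 §4; ★ FILE A p857347
∘ ★ FILE B p857407 ∘ FILE C; payer lineage LH4-p14, O-W LH4-p12 (g4)).  2026-09-04.
-/
import Summits.HodgeConjecture.HodgeConjecture.Theorems.F0P3cDyRamEigenFieldCompletionModel       -- ★ FILE A p857347 `exists_completionModel`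
import Summits.HodgeConjecture.HodgeConjecture.Theorems.F0P3cDyRamEigenFieldAdjointInvolution     -- ★ FILE B p857407 `exists_adjointInvolution_eigenvalue`, `v_eigenvalue_eq_one`, `v_adjoint_eq`
import Summits.HodgeConjecture.HodgeConjecture.Theorems.F0P3cDyRamIntegralInvolutionGenerator      -- FILE C `exists_integralGenerator`
import HarnessLib

/-!
# Crux `H413`, line LH4 «(D-RAM) FOUR-FRAME» road — unit U2H, (ρ2b′-X), organ T3-E part 2, FILE D: THE EIGEN-FIELD PACKAGE OF A TYPE-(2) BLOCK AT A NON-SPLIT PLACE, ASSEMBLED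

Cell `hodgecm-mathlib` (D-0151), FLOOR 0, crux item H413 = `stmt-HodgeConjecture-24833`, route of record `HCCMUnconditional`; squad F0∕P3c∕LH4; registered stub served:
`F0P3cDyRamFourFrameU2H.stub_U2H_fixedPointCensus_typeTwo_unit0` ((ρ2b′-X), U2H ED. 15 :418) through the organs of RHO2BX-ORDER v1 — organ T3-E (★ part 1 p857255
`F0P3cDyRamEllipticPlaneLineModel.exists_lineModel`; part 2 = ★ FILE A p857347, ★ FILE B p857407, FILE C, and THIS head).  THEOREMS ONLY (no `def`, no instance, no notation, no
`sorry`); lane `--supports stmt-HodgeConjecture-24833 --as helper` (count-neutral).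

WHAT THIS FILE DOES (plan §4 «deliverable shape»: the GLOBAL MODEL of the eigen-field enters as HYPOTHESES, discharged once at the top of the consumer's proof — the ★
`TypeTwoEigenFieldPackageWild.exists_eigenField_package_wildUnit` pattern).  Data: a number field `L`, a finite place `w`, a quadratic extension `E′ ∕ L` with non-trivial
automorphism `c`, `c δ = −δ`, `δ ≠ 0`, `δ² = m ∈ L` (the model `E′ = L(√m)`); on `K := L_w` an isometric involution `σ` and scalars `t D s` with `s ≠ 0`, `t² − 4D = s²·m`,
`D·σD = 1`, `t = D·σt`, and `X² − tX + D` ROOTLESS in `K` — the trace ∕ determinant of a `σ`-UNITARY TYPE-(2) block `γ₂ ∈ U(H₂)(K)` whose discriminant `t² − 4D` lies in the square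
class of `m` (★ `RamifiedQuadraticDictionaryWild.exists_isSquare_inv_mul_coe_of_ne_zero` supplies such `m ∈ L` at ANY place).
* `not_isSquare_of_rootless` — `X² − tX + D` rootless and `t² − 4D = s²m` ⇒ `m` is not a square in `K` (else `(t + s√m)∕2` is a root).
* **`exists_eigenPackage`** — there are the (unique, `c`-fixed) place `w′ ∣ w` of `E′`, a ring map `Θ` of `M := E′_{w′}` and `α, λ ∈ M` such that, with `jE := ι_{w′} : K →+* M`
  and `ρ := c_{w′}`: `ρρ = id`, `ρ` isometric, `ρ ∘ jE = jE`, `|jE a| ≤ 1 ↔ |a| ≤ 1`, `Fix ρ = jE(K)`; `Θ ∘ jE = jE ∘ σ`, `ΘΘ = id`, `Θρ = ρΘ`, `Θ` isometric; `ρα ≠ α`, `|α| ≤ 1`,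
  `hint`; `2λ = jE t + jE s·δ`, `λ² = jE t·λ − jE D`, `ρλ = jE t − λ`, `Θ(λ)·λ = 1`, `|λ| = 1`, unique coordinates on `(1, λ)` — i.e. EVERY binder of ★ (C)
  `EllipticPlaneAsFieldLine.ncard_selfDual_fixed_eq_ncard_orderLatt` (p857215) that concerns `(M, jE, ρ, Θ, α, λ)` and every metric binder of ★ (W4) `F0P3cDyRamWSideOrderCensus`,
  at once; ★ part 1 then yields `(φ, h)` from `γ₂`, `H₂`.
HONEST LABEL.  Count-neutral packaging (★ FILE A ∘ ★ FILE B ∘ FILE C); (ρ2b′-X) stays an OPEN prover target; `HC_CM` is proved only modulo the 7 printed citations (2 remaining named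
inputs: hLiu418 = `stmt-HodgeConjecture-24832`, h413 = `stmt-HodgeConjecture-24833`) until rung 0 closes.

## References
* [Rogawski1990] J. D. Rogawski, *Automorphic Representations of Unitary Groups in Three Variables*, Ann. of Math. Stud. 123 (1990), §4.9 Lemma 4.9.3 p. 56 (the elliptic torus of a
  regular element and its eigen-field with its two commuting involutions), §3.6 pp. 28–29.
* [Neukirch1999] J. Neukirch, *Algebraic Number Theory*, Grundlehren 322 (1999), Ch. II (8.2)–(8.3) (completions of a finite extension at the places above `w`).
* [Jacobowitz1962] R. Jacobowitz, *Hermitian forms over local fields*, Amer. J. Math. 84 (1962), §4.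
-/

set_option autoImplicit false

noncomputable section

open NumberField IsDedekindDomain
open Literature.NumberTheory.Automorphic Literature.NumberTheory.Automorphic.UnitaryGroup Literature.NumberTheory.NumberFields
open scoped ValuativeRel

namespace Summit.HodgeConjecture.HodgeConjecture.Cruxes.H413.F0P3cDyRamEigenFieldPackageTypeTwo

/-- `X² − tX + D` rootless in a field `K` with `2 ≠ 0` and `t² − 4D = s²·m` forces `m` to be a non-square (else `(t + s·r)∕2`, `r² = m`, is a root).
[cite: Rogawski1990, §4.9 Lemma 4.9.3 p. 56] -/
theorem not_isSquare_of_rootless {K : Type} [Field K] (h2 : (2 : K) ≠ 0) {t D s m : K} (hΔ : t * t - 4 * D = s * s * m) (hirr : ∀ x : K, x * x - t * x + D ≠ 0) :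
    ¬ IsSquare m := by
  rintro ⟨r, hr⟩
  apply hirr (2⁻¹ * (t + s * r))
  have h4 : (4 : K) ≠ 0 := by
    have : (4 : K) = 2 * 2 := by norm_num
    rw [this]; exact mul_ne_zero h2 h2
  apply mul_left_cancel₀ h4
  rw [mul_zero]
  have : (4 : K) * (2⁻¹ * (t + s * r) * (2⁻¹ * (t + s * r)) - t * (2⁻¹ * (t + s * r)) + D) = s * s * (r * r) - (t * t - 4 * D) := by
    field_simp
    ring
  rw [this, ← hr, hΔ, sub_self]

/-- **T3-E HEAD — THE EIGEN-FIELD PACKAGE OF A TYPE-(2) BLOCK AT A NON-SPLIT PLACE** (global model `E′ = L(√m)` as hypotheses).  See the module docstring for the list of clauses: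
`(hρρ, hvρ, hρj, hjv, hjfix)` from ★ FILE A, `(hΘj, hΘΘ, hΘρ, hvΘ)` and the `λ`-package `(2λ = t + sδ, λ² = tλ − D, ρλ = t − λ, Θλ·λ = 1, |λ| = 1, unique coordinates)` from ★ FILE B,
`(hα, hα1, hint)` from FILE C. [cite: Rogawski1990, §4.9 Lemma 4.9.3 p. 56] [cite: Neukirch1999, Ch. II (8.2)–(8.3)] [cite: Jacobowitz1962, §4] -/
theorem exists_eigenPackage {L : Type} [Field L] [NumberField L] (E' : Type) [Field E'] [NumberField E'] [Algebra L E'] [Algebra.IsQuadraticExtension L E']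
    (w : HeightOneSpectrum (𝓞 L)) (c : E' ≃ₐ[L] E') (hc1 : c ≠ 1) {δ : E'} (hcδ : c δ = -δ) (hδ : δ ≠ 0) {m : L} (hm : algebraMap L E' m = δ ^ 2)
    (σ : w.adicCompletion L →+* w.adicCompletion L) (hσσ : ∀ a, σ (σ a) = a) (hvσ : ∀ a, Valued.v (σ a) = Valued.v a)
    {t D s : w.adicCompletion L} (hs : s ≠ 0) (hΔ : t * t - 4 * D = s * s * (m : w.adicCompletion L)) (hDσ : D * σ D = 1) (htσ : t = D * σ t)
    (hirr : ∀ x : w.adicCompletion L, x * x - t * x + D ≠ 0) :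
    ∃ (w' : PlacesOver E' w) (hw' : c • w'.1 = w'.1) (Θ : w'.1.adicCompletion E' →+* w'.1.adicCompletion E') (α lam : w'.1.adicCompletion E'),
      -- ★ FILE A: `ρ := c_{w′}`, `jE := ι_{w′}`
      (∀ z, galAdicCompletionMap (L := E') c hw' (galAdicCompletionMap (L := E') c hw' z) = z) ∧
      (∀ z, Valued.v (galAdicCompletionMap (L := E') c hw' z) = Valued.v z) ∧
      (∀ a, galAdicCompletionMap (L := E') c hw' (toPlace w w' a) = toPlace w w' a) ∧
      (∀ a, Valued.v (toPlace w w' a) ≤ 1 ↔ Valued.v a ≤ 1) ∧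
      (∀ z : w'.1.adicCompletion E', galAdicCompletionMap (L := E') c hw' z = z ↔ ∃ a, toPlace w w' a = z) ∧
      -- ★ FILE B: the adjoint involution
      (∀ a, Θ (toPlace w w' a) = toPlace w w' (σ a)) ∧ (∀ z, Θ (Θ z) = z) ∧
      (∀ z, Θ (galAdicCompletionMap (L := E') c hw' z) = galAdicCompletionMap (L := E') c hw' (Θ z)) ∧ (∀ z, Valued.v (Θ z) = Valued.v z) ∧
      -- FILE C: the integral generator
      galAdicCompletionMap (L := E') c hw' α ≠ α ∧ Valued.v α ≤ 1 ∧
      (∀ z : w'.1.adicCompletion E', Valued.v z ≤ 1 → Valued.v ((z - galAdicCompletionMap (L := E') c hw' z) / (α - galAdicCompletionMap (L := E') c hw' α)) ≤ 1) ∧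
      -- ★ FILE B: the eigenvalue
      2 * lam = toPlace w w' t + toPlace w w' s * ((δ : E') : w'.1.adicCompletion E') ∧
      lam * lam = toPlace w w' t * lam - toPlace w w' D ∧
      galAdicCompletionMap (L := E') c hw' lam = toPlace w w' t - lam ∧
      Θ lam * lam = 1 ∧ Valued.v lam = 1 ∧
      (∀ z : w'.1.adicCompletion E', ∃! pq : w.adicCompletion L × w.adicCompletion L, z = toPlace w w' pq.1 + toPlace w w' pq.2 * lam) := by
  haveI : CharZero (w.adicCompletion L) := charZero_of_injective_algebraMap (algebraMap L (w.adicCompletion L)).injective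
  have h2 : (2 : w.adicCompletion L) ≠ 0 := two_ne_zero
  have hns : ¬ IsSquare (m : w.adicCompletion L) := not_isSquare_of_rootless h2 hΔ hirr
  -- ★ FILE A: the completed global model
  obtain ⟨w', hw', hρρ, hvρ, hρj, hjv, hδsq, hρδ, hcoord, hjfix⟩ :=
    F0P3cDyRamEigenFieldCompletionModel.exists_completionModel E' w c hc1 hcδ hδ hm hns
  have hspan : ∀ z : w'.1.adicCompletion E', ∃ pq : w.adicCompletion L × w.adicCompletion L,
      z = toPlace w w' pq.1 + toPlace w w' pq.2 * ((δ : E') : w'.1.adicCompletion E') := fun z => (hcoord z).exists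
  -- ★ FILE B: `Θ` and `λ`
  obtain ⟨Θ, lam, hΘj, hΘΘ, hΘρ, -, h2lam, hlam, hρlam, hΘlam, hcoordlam⟩ :=
    F0P3cDyRamEigenFieldAdjointInvolution.exists_adjointInvolution_eigenvalue σ hσσ (toPlace w w') (galAdicCompletionMap (L := E') c hw') hρj hns hδsq hρδ hspan
      h2 hs hΔ hDσ htσ
  have hvΘ : ∀ z, Valued.v (Θ z) = Valued.v z :=
    F0P3cDyRamEigenFieldAdjointInvolution.v_adjoint_eq σ hvσ (toPlace w w') hjv (galAdicCompletionMap (L := E') c hw') hρj hvρ hδsq hρδ hspan Θ hΘj hΘρ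
  have hDv : Valued.v D = 1 := F0P3cDyRamEigenFieldAdjointInvolution.v_eq_one_of_mul_map_self_eq_one σ hvσ hDσ
  have hρlamlam : galAdicCompletionMap (L := E') c hw' lam * lam = toPlace w w' D := by
    rw [hρlam]; linear_combination (-1 : w'.1.adicCompletion E') * hlam
  have hvlam : Valued.v lam = 1 :=
    F0P3cDyRamEigenFieldAdjointInvolution.v_eigenvalue_eq_one (toPlace w w') hjv (galAdicCompletionMap (L := E') c hw') hvρ hDv hρlamlam
  -- FILE C: `α` (ρ moves `δ`: `ρδ = −δ ≠ δ` as `δ ≠ 0`, `2 ≠ 0`)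
  have hδ0 : ((δ : E') : w'.1.adicCompletion E') ≠ 0 := by
    intro h0
    have hm0 : (m : w.adicCompletion L) ≠ 0 := fun hm0 => hns ⟨0, by rw [hm0, mul_zero]⟩
    apply (map_ne_zero (toPlace w w')).2 hm0
    rw [← hδsq, h0, zero_pow two_ne_zero]
  have h2M : (2 : w'.1.adicCompletion E') ≠ 0 := by rw [← map_ofNat (toPlace w w') 2]; exact (map_ne_zero _).2 h2
  have hmove : ∃ z, galAdicCompletionMap (L := E') c hw' z ≠ z :=
    ⟨((δ : E') : w'.1.adicCompletion E'), by
      rw [hρδ]; intro h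
      exact hδ0 (mul_left_cancel₀ h2M (by linear_combination -h))⟩
  obtain ⟨α, hα, hα1, hint⟩ := F0P3cDyRamIntegralInvolutionGenerator.exists_integralGenerator (galAdicCompletionMap (L := E') c hw') hvρ hmove
  exact ⟨w', hw', Θ, α, lam, hρρ, hvρ, hρj, hjv, hjfix, hΘj, hΘΘ, hΘρ, hvΘ, hα, hα1, hint, h2lam, hlam, hρlam, hΘlam, hvlam, hcoordlam⟩

end Summit.HodgeConjecture.HodgeConjecture.Cruxes.H413.F0P3cDyRamEigenFieldPackageTypeTwo

end
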